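import Summits.Ventures.AbcSig.Rows.TemplateC
import Summits.Ventures.AbcSig.Levels.N2

/-!
# Venture AbcSig — ROW: `xⁿ + yⁿ = z²`, `xy` even (level 2 has no newforms)

HONEST FRAMING. A CONDITIONAL theorem of a COMPUTATION cell (`pub-abcsig`); no claim on ABC or any summit. The case `C = 1`
of [BS04, Thm. 1.1] is Darmon–Merel's theorem in print; here only the `xy`-even half is recorded, as the degenerate instance
of the cell's row template: the Frey curve is in case (v), level `2·1² = 2`, and there are no weight-2 cusp forms of level 2
([BS04, Prop. 4.1]). Hypotheses: `BS04Package` (CITED) and `DataComplete 2 []` ("no newforms of level 2", CITED/COMPUTED).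
-/

namespace Summit.Ventures.AbcSig

/-- `xⁿ + yⁿ = z²` has no solution in nonzero pairwise coprime integers with `xy` even, for every prime `n ≥ 7`,
conditional on `BS04Package` and on "level 2 has no newforms". -/
theorem row_XnYnZ2Even (M : NewformModel) (hP : M.BS04Package) (hD2 : M.DataComplete 2 level2Orbits)
    (n : ℕ) (hn : n.Prime) (hmin : 7 ≤ n) (a b c : ℤ) (hpar : 2 ∣ a * b) : ¬ IsPrimitiveSolution 1 1 1 n a b c := by
  have hnC : ¬ n ∣ 1 := by
    intro h
    have := Nat.dvd_one.mp h
    omega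
  exact row_template_even 1 squarefree_one (by decide) M hP hD2 n hn hmin hnC
    (level2_sieve n hn hmin (fun o => M.Excludes 2 o (fun S => S.A = 1 ∧ S.B = 1 ∧ S.C = 1 ∧ S.n = n ∧ 2 ∣ S.a * S.b)))
    a b c hpar

end Summit.Ventures.AbcSig
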